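import Mathlib
import Summits.Ventures.DiscreteObjects.Mahler.NonreciprocalStructure

/-!
# The `x ↦ -x` symmetry of census cells: 33 runs give the 53 cells (venture `DiscreteObjects`, target L)

Cell `pub-namedobj`, seat `pub-namedobj-mahler` (gen 7). Framing: lottery ticket; floor = certified
bounds/negative ranges.

The kernel assembly of the height-bounded sub-Lehmer census up to degree `60` takes as hypotheses the
`53` cell statements `HeightCell h s d`, `(s, d) ∈ admissibleCellList` (`Height1CensusCellList`,
`HeightCells`, `NonreciprocalStructure.SmythFree`).  The cell's census plan (`CELLS-L60.md`, `cells60.json`)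
runs only `33` of them: the substitution `x ↦ -x` maps `Φ_m(x)` to `± Φ_{m⋆}(x)` with `1⋆ = 2`, `3⋆ = 6`,
`5⋆ = 10` (and back), `4⋆ = 4`, `8⋆ = 8`, `12⋆ = 12`, so the cell `(s, d)` and the cell `(s⋆, d)` are
EQUIVALENT (`heightCell_negXIndex_iff`): if `Q` is an irreducible reciprocal sub-Lehmer core with
`height (Φ_s · Q) ≤ h` then `Q(-x)` is one with `height (Φ_{s⋆} · Q(-x)) ≤ h` (Mahler measure, height,
irreducibility and degree are `x ↦ -x` invariant; reciprocity, `Q(0) ≠ 0` and cyclotomic-freeness of the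
new core come for free from `SmythFree.core_reverse_eq` & co.).  Hence the `33` run statements
(`runCellList`, transcribed from `cells60.json`) imply all `53` cells (`heightCells_of_runs`) and every
rung `≤ 60` (`heightSubLehmerEmptyUpTo_of_runs`, conditional on [MRW08, Thm 1.1] only).
The nine cyclotomic identities `Φ_m(-x) = ± Φ_{m⋆}(x)` are proved from explicit forms of
`Φ_1, …, Φ_12` (Mathlib's `cyclotomic_one/two/three/six`, and `Φ_4, Φ_5, Φ_8, Φ_10, Φ_12` derived here
from `cyclotomic_prime`, `cyclotomic_prime_pow_eq_geom_sum`, `cyclotomic_expand_eq_cyclotomic(_mul)`).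
-/

namespace Summit.Ventures.DiscreteObjects.Mahler

open Polynomial Literature.NumberTheory.MahlerMeasure

/-! ### `x ↦ -x` on integer polynomials -/

/-- Coefficients under `x ↦ -x` keep their absolute values: `|[xⁿ] p(-x)| = |[xⁿ] p(x)|`
(indeed `[xⁿ] p(-x) = (-1)ⁿ [xⁿ] p(x)`). -/
theorem natAbs_coeff_comp_neg_X (p : ℤ[X]) (n : ℕ) :
    ((p.comp (-X)).coeff n).natAbs = (p.coeff n).natAbs := by
  suffices h : ∀ q : ℤ[X], (q.comp (-X)).coeff n = (-1) ^ n * q.coeff n by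
    rw [h, Int.natAbs_mul, Int.natAbs_pow, Int.natAbs_neg, Int.natAbs_one, one_pow, one_mul]
  intro q
  induction q using Polynomial.induction_on' with
  | add p q hp hq => simp [add_comp, hp, hq, mul_add]
  | monomial k a =>
    rw [monomial_comp, coeff_monomial]
    have e : (C a * (-X) ^ k : ℤ[X]) = C (a * (-1) ^ k) * X ^ k := by
      rw [neg_pow, C_mul, C_pow, C_neg, C_1]; ring
    rw [e, coeff_C_mul_X_pow]
    by_cases hnk : n = k
    · subst hnk; simp; ring
    · simp [hnk, Ne.symm hnk]

/-- The height is `x ↦ -x` invariant. -/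
theorem height_comp_neg_X (p : ℤ[X]) : height (p.comp (-X)) = height p := by
  have key : ∀ q : ℤ[X], height (q.comp (-X)) ≤ height q := by
    intro q
    rw [height_le_iff]
    intro i
    rw [natAbs_coeff_comp_neg_X]
    exact (height_le_iff q (height q)).mp le_rfl i
  apply le_antisymm (key p)
  have := key (p.comp (-X))
  rwa [comp_neg_X_comp_neg_X] at this

/-- The Mahler measure is `x ↦ -x` invariant. -/
theorem intMahlerMeasure_comp_neg_X (p : ℤ[X]) : intMahlerMeasure (p.comp (-X)) = intMahlerMeasure p := by
  unfold intMahlerMeasure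
  rw [map_comp, Polynomial.map_neg, map_X, mahlerMeasure_comp_neg_X]

/-- `Q(-x)` is sub-Lehmer iff `Q` is. -/
theorem subLehmer_comp_neg_X_iff (p : ℤ[X]) : SubLehmer (p.comp (-X)) ↔ SubLehmer p := by
  unfold SubLehmer; rw [intMahlerMeasure_comp_neg_X]

/-- A unit `u(-x)` forces `u` to be a unit. -/
theorem isUnit_of_isUnit_comp_neg_X {p : ℤ[X]} (h : IsUnit (p.comp (-X))) : IsUnit p := by
  obtain ⟨r, hr, hrp⟩ := Polynomial.isUnit_iff.mp h
  have : p = C r := by rw [← comp_neg_X_comp_neg_X p, ← hrp, C_comp]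
  rw [this]; exact isUnit_C.mpr hr

/-- Irreducibility is `x ↦ -x` invariant. -/
theorem irreducible_comp_neg_X {Q : ℤ[X]} (hQ : Irreducible Q) : Irreducible (Q.comp (-X)) := by
  refine ⟨fun hu => hQ.not_isUnit (isUnit_of_isUnit_comp_neg_X hu), fun a b hab => ?_⟩
  have h : Q = a.comp (-X) * b.comp (-X) := by
    rw [← mul_comp_neg_X, ← hab, comp_neg_X_comp_neg_X]
  rcases hQ.isUnit_or_isUnit h with ha | hb
  · exact Or.inl (isUnit_of_isUnit_comp_neg_X ha)
  · exact Or.inr (isUnit_of_isUnit_comp_neg_X hb)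

/-! ### The index involution `m ↦ m⋆` and `Φ_m(-x) = ± Φ_{m⋆}(x)` -/

/-- The `x ↦ -x` involution on the census's cyclotomic indices: `1 ↔ 2`, `3 ↔ 6`, `5 ↔ 10`, all other
indices (in particular `4, 8, 12`) fixed. -/
def negXIndex (m : ℕ) : ℕ :=
  if m = 1 then 2 else if m = 2 then 1 else if m = 3 then 6 else if m = 6 then 3
  else if m = 5 then 10 else if m = 10 then 5 else m

/-- `m⋆⋆ = m`. -/
theorem negXIndex_negXIndex (m : ℕ) : negXIndex (negXIndex m) = m := by
  by_cases h1 : m = 1; · subst h1; decide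
  by_cases h2 : m = 2; · subst h2; decide
  by_cases h3 : m = 3; · subst h3; decide
  by_cases h6 : m = 6; · subst h6; decide
  by_cases h5 : m = 5; · subst h5; decide
  by_cases h10 : m = 10; · subst h10; decide
  have hm : negXIndex m = m := by simp [negXIndex, h1, h2, h3, h6, h5, h10]
  rw [hm, hm]

/-- `s⋆⋆ = s` for multisets of indices. -/
theorem map_negXIndex_map_negXIndex (s : Multiset ℕ) : (s.map negXIndex).map negXIndex = s := by
  rw [Multiset.map_map]
  conv_rhs => rw [← Multiset.map_id s]
  exact Multiset.map_congr rfl fun m _ => negXIndex_negXIndex m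

/-- `⋆` preserves the index set `{1,2,3,4,5,6,8,10,12}`. -/
theorem negXIndex_mem {m : ℕ} (hm : m ∈ cellIndexSet) : negXIndex m ∈ cellIndexSet := by
  revert m; unfold cellIndexSet negXIndex; decide

/-- `⋆` preserves `φ` on the index set. -/
theorem totient_negXIndex {m : ℕ} (hm : m ∈ cellIndexSet) : Nat.totient (negXIndex m) = Nat.totient m := by
  revert m; unfold cellIndexSet negXIndex; decide

/-- `Φ₄ = x² + 1` over `ℤ`. -/
theorem cyclotomic_four_int : cyclotomic 4 ℤ = X ^ 2 + 1 := by
  have h := cyclotomic_prime_pow_eq_geom_sum (R := ℤ) (n := 1) Nat.prime_two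
  norm_num [Finset.sum_range_succ] at h
  rw [h]; ring

/-- `Φ₈ = x⁴ + 1` over `ℤ`. -/
theorem cyclotomic_eight_int : cyclotomic 8 ℤ = X ^ 4 + 1 := by
  have h := cyclotomic_prime_pow_eq_geom_sum (R := ℤ) (n := 2) Nat.prime_two
  norm_num [Finset.sum_range_succ] at h
  rw [h]; ring

/-- `Φ₅ = x⁴ + x³ + x² + x + 1` over `ℤ`. -/
theorem cyclotomic_five_int : cyclotomic 5 ℤ = X ^ 4 + X ^ 3 + X ^ 2 + X + 1 := by
  haveI : Fact (Nat.Prime 5) := ⟨by norm_num⟩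
  rw [cyclotomic_prime]
  simp [Finset.sum_range_succ]
  ring

/-- `Φ₁₀ = x⁴ - x³ + x² - x + 1` over `ℤ` (from `Φ₁₀ · Φ₅ = Φ₅(x²)`). -/
theorem cyclotomic_ten_int : cyclotomic 10 ℤ = X ^ 4 - X ^ 3 + X ^ 2 - X + 1 := by
  have h := cyclotomic_expand_eq_cyclotomic_mul Nat.prime_two (by norm_num : ¬ 2 ∣ 5) ℤ
  rw [cyclotomic_five_int] at h
  norm_num [expand_X] at h
  have h5 : (X ^ 4 + X ^ 3 + X ^ 2 + X + 1 : ℤ[X]) ≠ 0 := by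
    intro h0; have := congrArg (fun p : ℤ[X] => p.eval 0) h0; simp at this
  have key : cyclotomic 10 ℤ * (X ^ 4 + X ^ 3 + X ^ 2 + X + 1) =
      (X ^ 4 - X ^ 3 + X ^ 2 - X + 1) * (X ^ 4 + X ^ 3 + X ^ 2 + X + 1) := by
    rw [← h]; ring
  exact mul_right_cancel₀ h5 key

/-- `Φ₁₂ = x⁴ - x² + 1` over `ℤ` (`= Φ₆(x²)`). -/
theorem cyclotomic_twelve_int : cyclotomic 12 ℤ = X ^ 4 - X ^ 2 + 1 := by
  have h := cyclotomic_expand_eq_cyclotomic Nat.prime_two (by norm_num : 2 ∣ 6) ℤ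
  rw [cyclotomic_six] at h
  norm_num [expand_X] at h
  rw [← h]; ring

/-- **`Φ_m(-x) = ± Φ_{m⋆}(x)`** for the nine census indices. -/
theorem cyclotomic_comp_neg_X_of_mem {m : ℕ} (hm : m ∈ cellIndexSet) :
    (cyclotomic m ℤ).comp (-X) = cyclotomic (negXIndex m) ℤ ∨
      (cyclotomic m ℤ).comp (-X) = -cyclotomic (negXIndex m) ℤ := by
  have hm' : m = 1 ∨ m = 2 ∨ m = 3 ∨ m = 4 ∨ m = 5 ∨ m = 6 ∨ m = 8 ∨ m = 10 ∨ m = 12 := by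
    simpa [cellIndexSet] using hm
  rcases hm' with rfl | rfl | rfl | rfl | rfl | rfl | rfl | rfl | rfl
  · right; simp [negXIndex, cyclotomic_one, cyclotomic_two]; ring
  · right; simp [negXIndex, cyclotomic_one, cyclotomic_two]; ring
  · left; simp [negXIndex, cyclotomic_three, cyclotomic_six]; ring
  · left; simp [negXIndex, cyclotomic_four_int]
  · left; simp [negXIndex, cyclotomic_five_int, cyclotomic_ten_int]; ring
  · left; simp [negXIndex, cyclotomic_three, cyclotomic_six]
  · left; simp [negXIndex, cyclotomic_eight_int]; ring
  · left; simp [negXIndex, cyclotomic_five_int, cyclotomic_ten_int]; ring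
  · left; simp [negXIndex, cyclotomic_twelve_int]; ring

/-- Product form: `(∏_{m ∈ s} Φ_m)(-x) = ± ∏_{m ∈ s} Φ_{m⋆}(x)`. -/
theorem cyclotomic_prod_comp_neg_X {s : Multiset ℕ} (hs : ∀ m ∈ s, m ∈ cellIndexSet) :
    ∃ u : ℤ, (u = 1 ∨ u = -1) ∧ ((s.map fun m => cyclotomic m ℤ).prod).comp (-X) =
      C u * ((s.map negXIndex).map fun m => cyclotomic m ℤ).prod := by
  induction s using Multiset.induction_on with
  | empty => exact ⟨1, Or.inl rfl, by simp⟩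
  | cons a t ih =>
    obtain ⟨u, hu, ht⟩ := ih (fun m hm => hs m (Multiset.mem_cons_of_mem hm))
    have ha := cyclotomic_comp_neg_X_of_mem (hs a (Multiset.mem_cons_self a t))
    rw [Multiset.map_cons, Multiset.prod_cons, mul_comp_neg_X, ht, Multiset.map_cons, Multiset.map_cons,
      Multiset.prod_cons]
    rcases ha with h | h
    · exact ⟨u, hu, by rw [h]; ring⟩
    · refine ⟨-u, by rcases hu with rfl | rfl <;> simp, ?_⟩
      rw [h, C_neg]; ring

/-! ### Transport of cells -/

/-- **Transport of a cell under `x ↦ -x`:** `HeightCell h s d → HeightCell h s⋆ d`. -/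
theorem heightCell_negXIndex {h : ℕ} {s : Multiset ℕ} {d : ℕ} (hs : ∀ m ∈ s, m ∈ cellIndexSet)
    (hcell : HeightCell h s d) : HeightCell h (s.map negXIndex) d := by
  intro Q hd hirr _ _ _ hheight hsub
  set Q' := Q.comp (-X) with hQ'
  have hsub' : SubLehmer Q' := (subLehmer_comp_neg_X_iff Q).mpr hsub
  have hirr' : Irreducible Q' := irreducible_comp_neg_X hirr
  have hd' : Q'.natDegree = d := by
    rw [hQ', natDegree_comp, natDegree_neg, natDegree_X, mul_one, hd]
  have hrev' : Q'.reverse = Q' := SmythFree.core_reverse_eq hirr' hsub'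
  have hc0' : Q'.coeff 0 ≠ 0 := core_coeff_zero_ne_zero hirr' hsub'
  have hncyc' : ∀ m : ℕ, 0 < m → ¬ cyclotomic m ℤ ∣ Q' := fun m hm => core_not_cyclotomic_dvd hirr' hsub' hm
  -- height: `Φ_s · Q' = ± (Φ_{s⋆} · Q)(-x)`
  have hs' : ∀ m ∈ s.map negXIndex, m ∈ cellIndexSet := by
    intro m hm
    obtain ⟨m₀, hm₀, rfl⟩ := Multiset.mem_map.mp hm
    exact negXIndex_mem (hs m₀ hm₀)
  obtain ⟨u, hu, hprod⟩ := cyclotomic_prod_comp_neg_X hs'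
  rw [map_negXIndex_map_negXIndex] at hprod
  have key : (s.map fun m => cyclotomic m ℤ).prod * Q' =
      C u * X ^ 0 * ((((s.map negXIndex).map fun m => cyclotomic m ℤ).prod * Q).comp (-X)) := by
    rw [mul_comp_neg_X, hprod, hQ']
    rcases hu with rfl | rfl <;> simp
  have hheight' : height ((s.map fun m => cyclotomic m ℤ).prod * Q') ≤ h := by
    rw [key, height_signed_shift hu 0, height_comp_neg_X]
    exact hheight
  exact hcell Q' hd' hirr' hrev' hc0' hncyc' hheight' hsub'

/-- The cells `(s, d)` and `(s⋆, d)` are equivalent. -/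
theorem heightCell_negXIndex_iff {h : ℕ} {s : Multiset ℕ} {d : ℕ} (hs : ∀ m ∈ s, m ∈ cellIndexSet) :
    HeightCell h (s.map negXIndex) d ↔ HeightCell h s d := by
  refine ⟨fun hc => ?_, heightCell_negXIndex hs⟩
  have hs' : ∀ m ∈ s.map negXIndex, m ∈ cellIndexSet := by
    intro m hm
    obtain ⟨m₀, hm₀, rfl⟩ := Multiset.mem_map.mp hm
    exact negXIndex_mem (hs m₀ hm₀)
  have := heightCell_negXIndex hs' hc
  rwa [map_negXIndex_map_negXIndex] at this

/-! ### The 33 runs -/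

/-- The `33` run representatives of the census plan (`cells60.json`, field `runs[].cofactor`, core
degree `d`): one cell per `x ↦ -x` orbit of admissible cells. -/
def runCellListRaw : List (List ℕ × ℕ) :=
  [([], 56), ([2], 56), ([3], 56), ([4], 56), ([1, 1], 56), ([1, 2], 56), ([2, 6], 56), ([2, 4], 56),
   ([2, 3], 56), ([2, 2, 2], 56), ([1, 1, 2], 56), ([5], 56), ([8], 56), ([12], 56), ([3, 3], 56),
   ([3, 4], 56), ([3, 6], 56), ([4, 4], 56), ([1, 1, 3], 56), ([1, 1, 4], 56), ([1, 1, 6], 56),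
   ([1, 2, 3], 56), ([1, 2, 4], 56), ([1, 1, 1, 1], 56), ([1, 1, 1, 2], 56), ([1, 1, 2, 2], 56),
   ([], 58), ([2], 58), ([3], 58), ([4], 58), ([1, 1], 58), ([1, 2], 58), ([], 60)]

/-- The run representatives as (multiset, degree) pairs. -/
def runCellList : List (Multiset ℕ × ℕ) :=
  runCellListRaw.map fun p => ((p.1 : Multiset ℕ), p.2)

/-- There are `33` runs. -/
theorem runCellList_length : runCellList.length = 33 := by decide

/-- Every run is an admissible cell. -/
theorem mem_admissibleCellList_of_mem_runCellList : ∀ p ∈ runCellList, p ∈ admissibleCellList := by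
  decide +kernel

/-- Every admissible cell is a run or the `⋆`-image of a run (kernel-decided). -/
theorem mem_runCellList_or_negXIndex :
    ∀ p ∈ admissibleCellList, p ∈ runCellList ∨ (p.1.map negXIndex, p.2) ∈ runCellList := by
  decide +kernel

/-- **The 33 runs give the 53 cells** (at any height bound `h`). -/
theorem heightCells_of_runs {h : ℕ} (hruns : ∀ p ∈ runCellList, HeightCell h p.1 p.2) :
    ∀ p ∈ admissibleCellList, HeightCell h p.1 p.2 := by
  intro p hp
  have hadm : AdmissibleCell p.1 p.2 := admissible_of_mem p hp
  rcases mem_runCellList_or_negXIndex p hp with h1 | h2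
  · exact hruns p h1
  · have := hruns _ h2
    exact (heightCell_negXIndex_iff hadm.1).mp this

/-- **Rung `N ≤ 60` at height `h` from the runs of total degree `≤ N`** (conditional on [MRW08, Thm 1.1]
only): e.g. `h = 1, N = 60` is the whole height-1 ladder from the `33` runs. -/
theorem heightSubLehmerEmptyUpTo_of_runs (hB : SubLehmerDegreeBound) {h N : ℕ} (hN : N ≤ 60)
    (hruns : ∀ p ∈ runCellList, (p.1.map Nat.totient).sum + p.2 ≤ N → HeightCell h p.1 p.2) :
    HeightSubLehmerEmptyUpTo h N := by
  refine SmythFree.heightSubLehmerEmptyUpTo_of_cellList hB hN fun p hp hle => ?_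
  have hadm : AdmissibleCell p.1 p.2 := admissible_of_mem p hp
  rcases mem_runCellList_or_negXIndex p hp with h1 | h2
  · exact hruns p h1 hle
  · have htot : ((p.1.map negXIndex).map Nat.totient).sum = (p.1.map Nat.totient).sum := by
      rw [Multiset.map_map]
      congr 1
      exact Multiset.map_congr rfl fun m hm => totient_negXIndex (hadm.1 m hm)
    have := hruns _ h2 (by show ((p.1.map negXIndex).map Nat.totient).sum + p.2 ≤ N; rw [htot]; exact hle)
    exact (heightCell_negXIndex_iff hadm.1).mp this

end Summit.Ventures.DiscreteObjects.Mahler
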